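import Summits.BirchSwinnertonDyer.Rank1Residual.Additive.ZpTowerUnramifiedLayer
import Literature.NumberTheory.GaloisRepresentations.LocalH2VanishingTrivialModule
import Literature.NumberTheory.GaloisRepresentations.FrobeniusPlaces
import Literature.NumberTheory.Automorphic.AshSmithTheoryHeckeProofs
import HarnessLib

/-!
# No `p`-th roots of unity in the completions of the layers `K_n` above a place `v ∤ p` with
# `N(v) ≢ 1 (mod p)` (row T-E3g-BUDn-CERT, ex-FILE 1; seat p10 GEN 5 — the `hμ` binder of the
# split-multiplicative layer witness of `TamagawaWitnessesLayer`)

HONEST FRAMING (cell `b2b-bsdres`, run/shared/lean/b2b/bsd-rank1-residual/, verbatim in every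
file): the goal of the cell is to DELETE the COMBINATION-SHAPED residual classes of the
Birch–Swinnerton-Dyer formula for ALL analytic-rank `≤ 1` elliptic curves over `ℚ` — "full BSD
formula for every rank `≤ 1` curve in class `C`" assembled STRICTLY from published theorems — so
that the rank-`≤ 1` remainder becomes exactly the CONSTRUCTION-SHAPED classes, which are TYPED
(missing-input `Prop`s), NOT attempted. This is not "finishing BSD". Team n1011 (N10/N11, the
Route-G LOWER budget node): research route; nothing is booked by this file; no mark / label
moved. THEOREMS ONLY: no definition, no named fact, no `sorry`.

## What (pure tower arithmetic; `K` any number field, `κ` ANY `ℤ_p`-extension, `v ∤ p`)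

* `inertiaDeg_layer_dvd_pow` — `f(w|v) ∣ pⁿ` for every place `w ∣ v` of `K_n = κ.layer n`
  (`v` is unramified in `K_n`, `ZpExtension.inertia_le_kerSubgroup_holds`; the tree's unramified
  place count `#{w ∣ v} · ord(Frob) = [K_n : K] = pⁿ` with `f(w|v) = ord(Frob)`, n1011-p01 FILE 4);
* `residueCard_layer_modEq` — **`N(w) ≡ N(v) (mod p)`** (`N(w) = N(v)^{f(w|v)}`,
  `residueCard_eq_residueCard_pow_inertiaDeg`; `f(w|v) = p^k`; `x^{p^k} = x` in `ℤ/p`);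
* `adicCompletion_layer_pow_eq_one_imp` — **`μ_p((K_n)_w) = 1` when `N(v) ≢ 1 (mod p)`**: the
  tree's `adicCompletion_pow_eq_one_imp` (Neukirch II (5.3)/(5.7): `ζ_p ∉ F` for a local field
  `F` of residue characteristic `≠ p` with `q_F ≢ 1 mod p`) at `(K_n)_w`;
* over `ℚ`: `residueCard_eq_of_prime_mem` (`N(v) = ℓ` for the place `v ∋ ℓ`) and
  `adicCompletion_layer_pow_eq_one_imp_rat` — the `hμ` binder of
  `exists_mem_unramifiedSubgroup_not_mem_kummerLocalConditionAt_layer_of_hasSplitMultiplicativeReductionAtPrime`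
  from the census datum `ℓ ≢ 1 (mod p)`.

(Dedup pointers by n1011-p01 GEN 3, INBOX 13:24Z.)  References: J. Neukirch, *ANT* II (5.3),
(5.7), I (9.4) [NeukirchANT1999]; L. C. Washington, *Introduction to Cyclotomic Fields* §13.1,
Prop. 13.2 [Washington1997].
-/

set_option autoImplicit false

noncomputable section

open scoped Classical NumberField

open IsDedekindDomain Field NumberField Literature.NumberTheory.GaloisRepresentations
  Literature.NumberTheory.EllipticCurves

namespace Summit.BirchSwinnertonDyer.Rank1Residual.Additive.ZpTower

/-! ### `f(w|v) ∣ pⁿ` and `N(w) ≡ N(v) (mod p)` -/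

section Layer

variable {K : Type} [Field K] [NumberField K] {p : ℕ} [hp : Fact p.Prime] (κ : ZpExtension K p)
  (n : ℕ)

/-- **`f(w|v) ∣ pⁿ`** for every place `w` of the layer `K_n` of a `ℤ_p`-extension above a place
`v ∤ p` of `K` (`v` unramified in `K_n`; `#{w ∣ v} · f = [K_n : K] = pⁿ`).
[cite: Washington1997, §13.1 and Prop. 13.2] [cite: NeukirchANT1999, Ch. I §9 Prop. (9.4)] -/
theorem inertiaDeg_layer_dvd_pow {v : HeightOneSpectrum (𝓞 K)} (hv : ((p : ℕ) : 𝓞 K) ∉ v.asIdeal)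
    (w : HeightOneSpectrum (𝓞 (κ.layer n))) (hw : w.under (𝓞 K) = v) :
    w.asIdeal.inertiaDeg (𝓞 K) ∣ p ^ n := by
  haveI : Fintype {w : HeightOneSpectrum (𝓞 (κ.layer n)) // w.under (𝓞 K) = v} :=
    @Fintype.ofFinite _ (finite_heightOneSpectrum_under_eq v)
  obtain ⟨𝔓, h𝔓⟩ := v.primesAbove_nonempty
  obtain ⟨σ, hσ⟩ := HeightOneSpectrum.exists_isArithFrobAt_of_mem_primesAbove_holds h𝔓
  have hrange := range_absGaloisRestrict_layer κ n
  have hN : (absGaloisRestrict K (κ.layer n)).toMonoidHom.range.Normal := by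
    rw [hrange]; infer_instance
  have hI : 𝔓.inertia (absoluteGaloisGroup K) ≤
      (absGaloisRestrict K (κ.layer n)).toMonoidHom.range := by
    rw [hrange]
    exact (ZpExtension.inertia_le_kerSubgroup_holds K p κ hv h𝔓).trans
      (κ.kerSubgroup_le_layerSubgroup n)
  have h1 := card_placesOver_mul_orderOf_eq_finrank K hN h𝔓 hI hσ
  rw [κ.finrank_layer_holds n, ← inertiaDeg_eq_orderOf K hN h𝔓 hI hσ w hw] at h1
  exact Dvd.intro_left _ h1

/-- **`N(w) ≡ N(v) (mod p)`** for every place `w` of the layer `K_n` of a `ℤ_p`-extension above a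
place `v ∤ p` of `K`: `N(w) = N(v)^{f(w|v)}` with `f(w|v)` a power of `p`, and `x^{p^k} = x` in
`ℤ/p`. [cite: NeukirchANT1999, Ch. I §8] [cite: Washington1997, §13.1] -/
theorem residueCard_layer_modEq {v : HeightOneSpectrum (𝓞 K)} (hv : ((p : ℕ) : 𝓞 K) ∉ v.asIdeal)
    (w : HeightOneSpectrum (𝓞 (κ.layer n))) (hw : w.under (𝓞 K) = v) :
    w.residueCard ≡ v.residueCard [MOD p] := by
  obtain ⟨k, -, hk⟩ := (Nat.dvd_prime_pow hp.out).mp (inertiaDeg_layer_dvd_pow κ n hv w hw)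
  rw [residueCard_eq_residueCard_pow_inertiaDeg (v := v) (w := w)
      (congrArg HeightOneSpectrum.asIdeal hw), hk,
    ← ZMod.natCast_eq_natCast_iff, Nat.cast_pow, ZMod.pow_card_pow]

/-- **`μ_p((K_n)_w) = 1`**: for a place `v ∤ p` of `K` with `N(v) ≢ 1 (mod p)` and every place
`w ∣ v` of a layer `K_n` of a `ℤ_p`-extension, the completion `(K_n)_w` contains no non-trivial
`p`-th root of unity (`N(w) ≡ N(v) ≢ 1`, and the tree's `adicCompletion_pow_eq_one_imp`).
[cite: NeukirchANT1999, II §5 Prop. (5.3) and (5.7)] [cite: Washington1997, §13.1] -/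
theorem adicCompletion_layer_pow_eq_one_imp {v : HeightOneSpectrum (𝓞 K)}
    (hv : ((p : ℕ) : 𝓞 K) ∉ v.asIdeal) (hq : ¬ v.residueCard ≡ 1 [MOD p])
    (w : HeightOneSpectrum (𝓞 (κ.layer n))) (hw : w.under (𝓞 K) = v) :
    ∀ ζ : w.adicCompletion (κ.layer n), ζ ^ p = 1 → ζ = 1 := by
  have hpw : ((p : ℕ) : 𝓞 (κ.layer n)) ∉ w.asIdeal := fun h ↦ hv (by
    rw [← hw, HeightOneSpectrum.under_asIdeal, Ideal.mem_under, map_natCast]; exact h)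
  exact adicCompletion_pow_eq_one_imp w hpw
    fun h ↦ hq ((residueCard_layer_modEq κ n hv w hw).symm.trans h)

end Layer

/-! ### Over `ℚ`: the census datum `ℓ ≢ 1 (mod p)` -/

section Rat

variable {p : ℕ} [hp : Fact p.Prime] (κ : ZpExtension ℚ p) (n : ℕ)

omit hp in
/-- `N(v) = ℓ` for the place `v ∋ ℓ` of `ℚ` (`N(v) ∣ ℓ`, `N(v) > 1`). [folklore] -/
theorem residueCard_eq_of_prime_mem {ℓ : ℕ} (hℓ : ℓ.Prime) {v : HeightOneSpectrum (𝓞 ℚ)}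
    (hℓv : ((ℓ : ℕ) : 𝓞 ℚ) ∈ v.asIdeal) : v.residueCard = ℓ :=
  ((Nat.dvd_prime hℓ).mp
    (Literature.NumberTheory.Automorphic.Ash2003.residueCard_dvd_of_natCast_mem hℓv)).resolve_left
    (HeightOneSpectrum.one_lt_residueCard v).ne'

/-- **`μ_p((ℚ_n)_w) = 1` above a prime `ℓ ≠ p` with `ℓ ≢ 1 (mod p)`**: for every `ℤ_p`-extension
`κ` of `ℚ`, every layer `ℚ_n`, and every place `w` of `ℚ_n` above the place `v ∋ ℓ` — the `hμ`
binder of `exists_mem_unramifiedSubgroup_not_mem_kummerLocalConditionAt_layer_of_hasSplitMultiplicativeReductionAtPrime`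
from the census datum. [cite: NeukirchANT1999, II §5 Prop. (5.3) and (5.7)] [cite: Washington1997, §13.1] -/
theorem adicCompletion_layer_pow_eq_one_imp_rat {ℓ : ℕ} (hℓ : ℓ.Prime) {v : HeightOneSpectrum (𝓞 ℚ)}
    (hℓv : ((ℓ : ℕ) : 𝓞 ℚ) ∈ v.asIdeal) (hne : ℓ ≠ p) (hq : ¬ ℓ ≡ 1 [MOD p])
    (w : HeightOneSpectrum (𝓞 (κ.layer n))) (hw : w.under (𝓞 ℚ) = v) :
    ∀ ζ : w.adicCompletion (κ.layer n), ζ ^ p = 1 → ζ = 1 := by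
  have hpv : ((p : ℕ) : 𝓞 ℚ) ∉ v.asIdeal := fun h ↦
    hne ((residueCard_eq_of_prime_mem hℓ hℓv).symm.trans (residueCard_eq_of_prime_mem hp.out h))
  refine adicCompletion_layer_pow_eq_one_imp κ n hpv ?_ w hw
  rwa [residueCard_eq_of_prime_mem hℓ hℓv]

end Rat

end Summit.BirchSwinnertonDyer.Rank1Residual.Additive.ZpTower

end
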